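import Literature.Geometry.ComplexHyperbolic.UnitBallTwoLevelIntegral            -- ★ p843942 (this seat): brings `U21`, `mat`, `stabilizer U21 x₀` (compact, Haar), ★ `UnitBallInvariantMeasure`, ★ `UnitBallBounds` (`mat_inv`)
import Literature.MeasureTheory.Group.HaarRightInvariantCompactSubgroup         -- ★ p843748: a left Haar measure is right-invariant under a compact subgroup
import Literature.Analysis.FunctionSpaces.ParametricIntegralSmooth              -- ★ `contDiff_parametric_integral`
import HarnessLib

/-!
# The `K`-conjugation average `Θ^K(X) = ∫_K Θ(k·X·k⁻¹) dm_K` of a test function on `U(2,1)`: smoothness, `K`-invariance, value at the centre, and `Φ_Θ = Φ_{Θ^K}`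
# (Helgason 2000 Ch. I §1; Hörmander I Thm. 1.1.9; Rogawski 1990 §8.4 — the reduction behind the KAK form of the regular orbital integral)

Topic `Geometry/ComplexHyperbolic`; namespace `Literature.Geometry.ComplexHyperbolic.BallModel`.  THEOREMS ONLY (no `def`, no instance, no notation, no axiom, no named fact, no `sorry`; the
average is written inline as `fun X => ∫ k, Θ (mat ↑k * X * mat ↑k⁻¹) ∂haar`).  Cell `pub/hodgecm-mathlib`, ENGINE T1 (crux H413 = `stmt-HodgeConjecture-24833`); ROAD A (N1 = `stub_L21` ∕
`stub_ArchCentralLimitU21`); the reduction used in the owner's census `CENSUS-beta-TwoScaleRegularOrbital` §1 (KAK form: for `K`-conjugation-invariant `Θ` the regular orbital integral is a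
3-dimensional explicit integral) and in p06 (g12)'s mechanism note 2026-09-01T10:40:20Z («`V(Θ) = V(Θ^K)`»); author F0P3a-p05 (g14) (ROAD A owner), 2026-09-01.

THE MATHEMATICS.  `G = U(2,1)` (`U21`), `K = Stab(x₀) ≅ U(2)×U(1)` compact with Haar measure `m_K = haar`, `μ` a (left) Haar measure on `G`.  For `Θ : M₃(ℂ) → E` put
`Θ^K(X) := ∫_K Θ(mat k · X · mat k⁻¹) dm_K(k)`.  Then:
* §1 `Θ^K(ζ•1) = m_K(K) • Θ(ζ•1)` (scalars are central); `Θ^K` is `K`-CONJUGATION INVARIANT, `Θ^K(mat k₀ · X · mat k₀⁻¹) = Θ^K(X)` (right-invariance of `m_K` on the COMPACT group `K`, ★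
  `integral_comp_mul_right_of_mem_isCompact`); `Θ^K ∈ C^∞` for `Θ ∈ C^∞` (★ `contDiff_parametric_integral`: finite measure, `ι(k) = (mat k, mat k⁻¹)` in a compact); continuity for continuous `Θ`.
* §2 **`Φ_Θ = m_K(K)⁻¹ • Φ_{Θ^K}`**: for every `t ∈ G` and `Θ` continuous with `g ↦ Θ(mat(g t g⁻¹))` compactly supported,
  `m_K(K) • ∫_G Θ(mat(g·t·g⁻¹)) dμ(g) = ∫_G Θ^K(mat(g·t·g⁻¹)) dμ(g)` (left-invariance `g ↦ k·g` of `μ` for each `k`, then Fubini over the compact `K`) — orbital integrals see only the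
  `K`-average of the test function, so every engine downstream may assume `Θ` is `K`-conjugation invariant (same value at the centre up to the harmless `m_K(K)`).
HONEST LABEL: HC_CM is proved only modulo the printed citations until rung 0 closes; measure-theoretic bookkeeping over ★ files, pays nothing by itself.

## References
* [Helgason2000] S. Helgason, *Groups and Geometric Analysis* (2000), Ch. I §1 No. 1–2 (invariant integration, `K`-averages).
* [HormanderALPDO1] L. Hörmander, *The Analysis of Linear Partial Differential Operators I*, 2nd ed. (1990), Thm. 1.1.9 (differentiation under the integral sign).
* [Rogawski1990] J. D. Rogawski, *Automorphic Representations of Unitary Groups in Three Variables*, Ann. of Math. Stud. 123 (1990), §8.4 pp. 126–127.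
-/

set_option autoImplicit false

noncomputable section

open Matrix MeasureTheory Measure MulAction Topology Set Function
open scoped ENNReal NNReal ContDiff Matrix.Norms.Operator

namespace Literature.Geometry.ComplexHyperbolic

namespace BallModel

/-! ## §0 Generic: parametric integrals over a compact space with continuous data map -/

section Generic

variable {W : Type*} [TopologicalSpace W] [CompactSpace W] [MeasurableSpace W] [OpensMeasurableSpace W] (ρ : Measure W) [IsFiniteMeasure ρ]
  {P : Type*} [NormedAddCommGroup P] [NormedSpace ℝ P] [SecondCountableTopology P]
  {V : Type*} [NormedAddCommGroup V] [NormedSpace ℝ V] [FiniteDimensional ℝ V]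
  {F : Type*} [NormedAddCommGroup F] [NormedSpace ℝ F]

/-- ★ `contDiff_parametric_integral` with a CONTINUOUS data map `ι` on a COMPACT space (the compact set is `range ι`; the Borel structure on `P` is supplied locally, so callers need none).
[cite: HormanderALPDO1, Thm. 1.1.9] -/
theorem contDiff_parametric_integral_of_continuous (ι : W → P) (hι : Continuous ι) {G : P × V → F} (hG : ContDiff ℝ ∞ G) :
    ContDiff ℝ ∞ fun p : V => ∫ w, G (ι w, p) ∂ρ := by
  letI : MeasurableSpace P := borel P
  haveI : BorelSpace P := ⟨rfl⟩
  exact Literature.Analysis.FunctionSpaces.contDiff_parametric_integral (μ := ρ) hι.measurable (isCompact_range hι)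
    (Filter.Eventually.of_forall fun w => mem_range_self w) hG

omit [NormedSpace ℝ P] in
/-- ★ `continuous_parametric_integral` with a continuous data map on a compact space. [cite: HormanderALPDO1, Thm. 1.1.9] -/
theorem continuous_parametric_integral_of_continuous (ι : W → P) (hι : Continuous ι) {G : P × V → F} (hG : Continuous G) :
    Continuous fun p : V => ∫ w, G (ι w, p) ∂ρ := by
  letI : MeasurableSpace P := borel P
  haveI : BorelSpace P := ⟨rfl⟩
  exact Literature.Analysis.FunctionSpaces.continuous_parametric_integral (μ := ρ) hι.measurable (isCompact_range hι)
    (Filter.Eventually.of_forall fun w => mem_range_self w) hG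

end Generic

/-! ## §1 The `K`-average of a test function -/

section Average

variable {E : Type*} [NormedAddCommGroup E] [NormedSpace ℝ E]

/-- `mat k · mat k⁻¹ = 1` and `mat k⁻¹ · mat k = 1` for `k ∈ K`. [cite: Helgason2000, Ch. I §1 No. 1] -/
theorem mat_coe_mul_mat_coe_inv (k : stabilizer U21 x₀) : mat (k : U21) * mat ((k⁻¹ : stabilizer U21 x₀) : U21) = 1 := by
  rw [← mat_mul, Subgroup.coe_inv, mul_inv_cancel, mat_one]

/-- **VALUE AT THE CENTRE**: `Θ^K(ζ•1) = m_K(K) • Θ(ζ•1)` (scalar matrices are central). [cite: Helgason2000, Ch. I §1 No. 2] -/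
theorem kAverage_smul_one [CompleteSpace E] (Θ : Matrix (Fin 3) (Fin 3) ℂ → E) (ζ : ℂ) :
    ∫ k : stabilizer U21 x₀, Θ (mat (k : U21) * (ζ • (1 : Matrix (Fin 3) (Fin 3) ℂ)) * mat ((k⁻¹ : stabilizer U21 x₀) : U21)) ∂haar =
      (haar : Measure (stabilizer U21 x₀)).real univ • Θ (ζ • (1 : Matrix (Fin 3) (Fin 3) ℂ)) := by
  have h : ∀ k : stabilizer U21 x₀, mat (k : U21) * (ζ • (1 : Matrix (Fin 3) (Fin 3) ℂ)) * mat ((k⁻¹ : stabilizer U21 x₀) : U21) = ζ • (1 : Matrix (Fin 3) (Fin 3) ℂ) := fun k => by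
    rw [Matrix.mul_smul, Matrix.mul_one, Matrix.smul_mul, mat_coe_mul_mat_coe_inv]
  simp_rw [h]
  rw [integral_const]

/-- **`K`-CONJUGATION INVARIANCE OF THE AVERAGE**: `Θ^K(mat k₀ · X · mat k₀⁻¹) = Θ^K(X)` — the Haar measure of the COMPACT group `K` is right-invariant (★ `integral_comp_mul_right_of_mem_isCompact`
with the compact subgroup `⊤ ≤ K`), and `mat(k·k₀) = mat k · mat k₀`. [cite: Helgason2000, Ch. I §1 No. 1] -/
theorem kAverage_conj (Θ : Matrix (Fin 3) (Fin 3) ℂ → E) (k₀ : stabilizer U21 x₀) (X : Matrix (Fin 3) (Fin 3) ℂ) :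
    ∫ k : stabilizer U21 x₀, Θ (mat (k : U21) * (mat (k₀ : U21) * X * mat ((k₀⁻¹ : stabilizer U21 x₀) : U21)) * mat ((k⁻¹ : stabilizer U21 x₀) : U21)) ∂haar =
      ∫ k : stabilizer U21 x₀, Θ (mat (k : U21) * X * mat ((k⁻¹ : stabilizer U21 x₀) : U21)) ∂haar := by
  have h := Literature.MeasureTheory.Group.integral_comp_mul_right_of_mem_isCompact (haar : Measure (stabilizer U21 x₀)) (⊤ : Subgroup (stabilizer U21 x₀))
    (by simpa using isCompact_univ (X := stabilizer U21 x₀)) (k := k₀) (Subgroup.mem_top k₀)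
    (fun k : stabilizer U21 x₀ => Θ (mat (k : U21) * X * mat ((k⁻¹ : stabilizer U21 x₀) : U21)))
  rw [← h]
  refine integral_congr_ae (Filter.Eventually.of_forall fun k => ?_)
  simp only [_root_.mul_inv_rev, Subgroup.coe_mul, Subgroup.coe_inv, mat_mul, Matrix.mul_assoc]

/-- **`Θ^K ∈ C^∞` FOR `Θ ∈ C^∞`** (iterated differentiation under the integral over the compact group `K`: ★ `contDiff_parametric_integral` with the finite Haar measure, `ι(k) = (mat k, mat k⁻¹)`
continuous into the compact `ι(K)`, `G((P,Q),X) = Θ(P·X·Q)` jointly smooth). [cite: HormanderALPDO1, Thm. 1.1.9] -/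
theorem contDiff_kAverage (Θ : Matrix (Fin 3) (Fin 3) ℂ → E) (hΘ : ContDiff ℝ ∞ Θ) :
    ContDiff ℝ ∞ fun X : Matrix (Fin 3) (Fin 3) ℂ => ∫ k : stabilizer U21 x₀, Θ (mat (k : U21) * X * mat ((k⁻¹ : stabilizer U21 x₀) : U21)) ∂haar := by
  have hιc : Continuous fun k : stabilizer U21 x₀ => (mat (k : U21), mat ((k⁻¹ : stabilizer U21 x₀) : U21)) :=
    (continuous_mat.comp continuous_subtype_val).prodMk (continuous_mat.comp (continuous_subtype_val.comp continuous_inv))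
  have hG : ContDiff ℝ ∞ fun q : (Matrix (Fin 3) (Fin 3) ℂ × Matrix (Fin 3) (Fin 3) ℂ) × Matrix (Fin 3) (Fin 3) ℂ => Θ (q.1.1 * q.2 * q.1.2) :=
    hΘ.comp (((contDiff_fst.comp contDiff_fst).mul contDiff_snd).mul (contDiff_snd.comp contDiff_fst))
  exact contDiff_parametric_integral_of_continuous (haar : Measure (stabilizer U21 x₀)) _ hιc hG

/-- `Θ^K` is continuous for continuous `Θ` (continuity of parametric integrals over the compact `K`). [cite: HormanderALPDO1, Thm. 1.1.9] -/
theorem continuous_kAverage (Θ : Matrix (Fin 3) (Fin 3) ℂ → E) (hΘ : Continuous Θ) :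
    Continuous fun X : Matrix (Fin 3) (Fin 3) ℂ => ∫ k : stabilizer U21 x₀, Θ (mat (k : U21) * X * mat ((k⁻¹ : stabilizer U21 x₀) : U21)) ∂haar := by
  have hιc : Continuous fun k : stabilizer U21 x₀ => (mat (k : U21), mat ((k⁻¹ : stabilizer U21 x₀) : U21)) :=
    (continuous_mat.comp continuous_subtype_val).prodMk (continuous_mat.comp (continuous_subtype_val.comp continuous_inv))
  have hG : Continuous fun q : (Matrix (Fin 3) (Fin 3) ℂ × Matrix (Fin 3) (Fin 3) ℂ) × Matrix (Fin 3) (Fin 3) ℂ => Θ (q.1.1 * q.2 * q.1.2) :=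
    hΘ.comp (((continuous_fst.comp continuous_fst).mul continuous_snd).mul (continuous_snd.comp continuous_fst))
  exact continuous_parametric_integral_of_continuous (haar : Measure (stabilizer U21 x₀)) _ hιc hG

end Average

/-! ## §2 Orbital integrals see only the `K`-average of the test function -/

section Orbital

variable {E : Type*} [NormedAddCommGroup E] [NormedSpace ℝ E] [CompleteSpace E]
variable (μ : Measure U21) [μ.IsMulLeftInvariant] [IsFiniteMeasureOnCompacts μ]

/-- `mat((k·g)·t·(k·g)⁻¹) = mat k · mat(g·t·g⁻¹) · mat k⁻¹`. [cite: Helgason2000, Ch. I §1 No. 1] -/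
theorem mat_conj_mul_left (k g t : U21) : mat (k * g * t * (k * g)⁻¹) = mat k * mat (g * t * g⁻¹) * mat k⁻¹ := by
  simp only [_root_.mul_inv_rev, mat_mul, Matrix.mul_assoc]

omit [CompleteSpace E] [IsFiniteMeasureOnCompacts μ] in
/-- **LEFT-INVARIANCE STEP**: `∫_G Θ(mat(g·t·g⁻¹)) dμ = ∫_G Θ(mat k · mat(g·t·g⁻¹) · mat k⁻¹) dμ` for every `k` (`μ` left-invariant, `g ↦ k·g`). [cite: Helgason2000, Ch. I §1 No. 1] -/
theorem integral_comp_conj_eq_integral_comp_conj_conj (Θ : Matrix (Fin 3) (Fin 3) ℂ → E) (t k : U21) :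
    ∫ g, Θ (mat (g * t * g⁻¹)) ∂μ = ∫ g, Θ (mat k * mat (g * t * g⁻¹) * mat k⁻¹) ∂μ := by
  have h := integral_mul_left_eq_self (μ := μ) (fun g : U21 => Θ (mat (g * t * g⁻¹))) k
  rw [← h]
  refine integral_congr_ae (Filter.Eventually.of_forall fun g => ?_)
  simp only [mat_conj_mul_left]

omit [NormedSpace ℝ E] [CompleteSpace E] [μ.IsMulLeftInvariant] in
/-- Joint integrability of `(g,k) ↦ Θ(mat k · mat(g·t·g⁻¹) · mat k⁻¹)` on `μ ⊗ m_K` when `g ↦ Θ(mat(g·t·g⁻¹))` is continuous with compact support `C`: the integrand is continuous and supported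
in `(K⁻¹·C) × K`. [cite: Helgason2000, Ch. I §1 No. 2] -/
theorem integrable_comp_conj_conj_prod (Θ : Matrix (Fin 3) (Fin 3) ℂ → E) (hΘ : Continuous Θ) (t : U21)
    (hc : HasCompactSupport fun g : U21 => Θ (mat (g * t * g⁻¹))) :
    Integrable (fun p : U21 × stabilizer U21 x₀ => Θ (mat (p.2 : U21) * mat (p.1 * t * p.1⁻¹) * mat ((p.2⁻¹ : stabilizer U21 x₀) : U21))) (μ.prod haar) := by
  have hcont : Continuous fun p : U21 × stabilizer U21 x₀ => Θ (mat (p.2 : U21) * mat (p.1 * t * p.1⁻¹) * mat ((p.2⁻¹ : stabilizer U21 x₀) : U21)) :=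
    hΘ.comp ((((continuous_mat.comp (continuous_subtype_val.comp continuous_snd)).mul ((continuous_mat_conj t).comp continuous_fst))).mul
      (continuous_mat.comp (continuous_subtype_val.comp (continuous_inv.comp continuous_snd))))
  -- support ⊆ (K⁻¹ · tsupport) × univ, via `Θ(mat k X mat k⁻¹) = (g ↦ Θ(mat(g t g⁻¹)))(k·g)`
  have hsupp : HasCompactSupport fun p : U21 × stabilizer U21 x₀ => Θ (mat (p.2 : U21) * mat (p.1 * t * p.1⁻¹) * mat ((p.2⁻¹ : stabilizer U21 x₀) : U21)) := by
    refine HasCompactSupport.of_support_subset_isCompact ((isCompact_stabilizer_x₀.inv.mul hc.isCompact).prod isCompact_univ) ?_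
    intro p hp
    refine ⟨?_, mem_univ _⟩
    have hne : Θ (mat ((p.2 : U21) * p.1 * t * ((p.2 : U21) * p.1)⁻¹)) ≠ 0 := by
      rw [mat_conj_mul_left]; simpa only [Subgroup.coe_inv, Function.mem_support] using hp
    have hmem : (p.2 : U21) * p.1 ∈ tsupport fun g : U21 => Θ (mat (g * t * g⁻¹)) := subset_tsupport _ hne
    exact ⟨((p.2 : U21))⁻¹, Set.inv_mem_inv.2 p.2.2, (p.2 : U21) * p.1, hmem, by group⟩
  exact hcont.integrable_of_hasCompactSupport hsupp

/-- **ORBITAL INTEGRALS SEE ONLY `Θ^K`**: for a left-invariant measure `μ` on `G = U(2,1)`, every `t ∈ G` and every continuous `Θ` with `g ↦ Θ(mat(g·t·g⁻¹))` compactly supported,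
`m_K(K) • ∫_G Θ(mat(g·t·g⁻¹)) dμ(g) = ∫_G Θ^K(mat(g·t·g⁻¹)) dμ(g)`, `Θ^K(X) = ∫_K Θ(mat k·X·mat k⁻¹) dm_K` (§1: smooth, `K`-invariant, `Θ^K(ζ•1) = m_K(K)•Θ(ζ•1)`).
[cite: Helgason2000, Ch. I §1 No. 2] [cite: Rogawski1990, §8.4 pp. 126–127] -/
theorem smul_integral_comp_conj_eq_integral_kAverage_comp_conj (Θ : Matrix (Fin 3) (Fin 3) ℂ → E) (hΘ : Continuous Θ) (t : U21)
    (hc : HasCompactSupport fun g : U21 => Θ (mat (g * t * g⁻¹))) :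
    (haar : Measure (stabilizer U21 x₀)).real univ • ∫ g, Θ (mat (g * t * g⁻¹)) ∂μ =
      ∫ g, (∫ k : stabilizer U21 x₀, Θ (mat (k : U21) * mat (g * t * g⁻¹) * mat ((k⁻¹ : stabilizer U21 x₀) : U21)) ∂haar) ∂μ := by
  have hF := integrable_comp_conj_conj_prod μ Θ hΘ t hc
  rw [integral_integral_swap hF]
  have h : ∀ k : stabilizer U21 x₀, ∫ g, Θ (mat (k : U21) * mat (g * t * g⁻¹) * mat ((k⁻¹ : stabilizer U21 x₀) : U21)) ∂μ = ∫ g, Θ (mat (g * t * g⁻¹)) ∂μ := fun k => by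
    rw [integral_comp_conj_eq_integral_comp_conj_conj μ Θ t (k : U21), Subgroup.coe_inv]
  simp_rw [h]
  rw [integral_const]

end Orbital

/-! ## §3 (ED. 2) Compact support of `Θ^K` on the group, and `K`-invariance in matrix form (p06 (g12)'s `hK` binder) -/

section EdTwo

variable {E : Type*} [NormedAddCommGroup E] [NormedSpace ℝ E]

/-- **`g ↦ Θ^K(mat g)` HAS COMPACT SUPPORT ON `U(2,1)`** when `g ↦ Θ(mat g)` has: `Θ^K(mat g) ≠ 0` forces `Θ(mat(k·g·k⁻¹)) ≠ 0` for some `k ∈ K`, so `g ∈ K·C·K` with `C = tsupport(Θ∘mat)`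
(`K` compact ★ `isCompact_stabilizer_x₀`). [cite: Helgason2000, Ch. I §1 No. 2] -/
theorem hasCompactSupport_kAverage_comp_mat (Θ : Matrix (Fin 3) (Fin 3) ℂ → E) (hc : HasCompactSupport fun g : U21 => Θ (mat g)) :
    HasCompactSupport fun g : U21 => ∫ k : stabilizer U21 x₀, Θ (mat (k : U21) * mat g * mat ((k⁻¹ : stabilizer U21 x₀) : U21)) ∂haar := by
  refine HasCompactSupport.of_support_subset_isCompact ((isCompact_stabilizer_x₀.mul hc.isCompact).mul isCompact_stabilizer_x₀) ?_
  intro g hg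
  rw [Function.mem_support] at hg
  -- some fibre value is non-zero
  obtain ⟨k, hk⟩ : ∃ k : stabilizer U21 x₀, Θ (mat (k : U21) * mat g * mat ((k⁻¹ : stabilizer U21 x₀) : U21)) ≠ 0 := by
    by_contra h
    push Not at h
    exact hg (by simp_rw [h, integral_zero])
  have hmem : (k : U21) * g * ((k⁻¹ : stabilizer U21 x₀) : U21) ∈ tsupport (fun g : U21 => Θ (mat g)) := by
    apply subset_tsupport
    rw [Function.mem_support, mat_mul, mat_mul]
    exact hk
  refine ⟨(k : U21)⁻¹ * ((k : U21) * g * ((k⁻¹ : stabilizer U21 x₀) : U21)), ⟨(k : U21)⁻¹, ?_, _, hmem, rfl⟩, (k : U21), k.2, ?_⟩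
  · exact (stabilizer U21 x₀).inv_mem k.2
  · simp only [Subgroup.coe_inv]; group

/-- A matrix commuting with `J` has vanishing `(0,2)` entry. [cite: Jacobowitz1990, Ch. 2 §1 Lemma 6(2)] -/
theorem apply_zero_two_eq_zero_of_comm_J {κ : Matrix (Fin 3) (Fin 3) ℂ} (hκJ : κ * J = J * κ) : κ 0 2 = 0 := by
  have h := congrFun (congrFun hκJ 0) 2
  rw [J, Matrix.mul_diagonal, Matrix.diagonal_mul] at h
  simp at h
  linear_combination -(h / 2)

/-- A matrix commuting with `J` has vanishing `(1,2)` entry. [cite: Jacobowitz1990, Ch. 2 §1 Lemma 6(2)] -/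
theorem apply_one_two_eq_zero_of_comm_J {κ : Matrix (Fin 3) (Fin 3) ℂ} (hκJ : κ * J = J * κ) : κ 1 2 = 0 := by
  have h := congrFun (congrFun hκJ 1) 2
  rw [J, Matrix.mul_diagonal, Matrix.diagonal_mul] at h
  simp at h
  linear_combination -(h / 2)

/-- A unitary matrix commuting with `J` lies in `U(2,1)` (`κᴴJκ = κᴴκJ = J`). [cite: Jacobowitz1990, Ch. 2 §1 Lemma 6(2)] -/
theorem conjTranspose_mul_J_mul_of_unitary_comm_J {κ : Matrix (Fin 3) (Fin 3) ℂ} (hκ : κ * κᴴ = 1) (hκJ : κ * J = J * κ) : κᴴ * J * κ = J := by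
  have hκ' : κᴴ * κ = 1 := mul_eq_one_comm.1 hκ
  rw [Matrix.mul_assoc, ← hκJ, ← Matrix.mul_assoc, hκ', Matrix.one_mul]

/-- … and fixes the base point: `mkU21 κ _ • x₀ = x₀` (its last column is `(0,0,κ₂₂)`). [cite: Jacobowitz1990, Ch. 2 §1 Lemma 6(2)] -/
theorem mkU21_smul_x₀_of_unitary_comm_J {κ : Matrix (Fin 3) (Fin 3) ℂ} (hκ : κ * κᴴ = 1) (hκJ : κ * J = J * κ) :
    mkU21 κ (conjTranspose_mul_J_mul_of_unitary_comm_J hκ hκJ) • x₀ = x₀ := by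
  apply Ball.ext
  intro i
  rw [smul_val, W3_x₀, W3_x₀, mat_mkU21, x₀_val, Pi.zero_apply]
  fin_cases i
  · simp [apply_zero_two_eq_zero_of_comm_J hκJ]
  · simp [apply_one_two_eq_zero_of_comm_J hκJ]

/-- **`K`-INVARIANCE OF `Θ^K` IN MATRIX FORM** (p06 (g12)'s W6 binder `hK`): for every `κ ∈ M₃(ℂ)` with `κ κᴴ = 1` and `κ J = J κ` — i.e. `κ ∈ U(2)×U(1) = Stab(x₀)` as a matrix —
`Θ^K(κ·X·κᴴ) = Θ^K(X)` (★ `kAverage_conj` at `k₀ = mkU21 κ`, `mat k₀⁻¹ = J κᴴ J = κᴴ`). [cite: Helgason2000, Ch. I §1 No. 1] [cite: Jacobowitz1990, Ch. 2 §1 Lemma 6(2)] -/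
theorem kAverage_conj_of_unitary_comm_J (Θ : Matrix (Fin 3) (Fin 3) ℂ → E) {κ : Matrix (Fin 3) (Fin 3) ℂ} (hκ : κ * κᴴ = 1) (hκJ : κ * J = J * κ)
    (X : Matrix (Fin 3) (Fin 3) ℂ) :
    ∫ k : stabilizer U21 x₀, Θ (mat (k : U21) * (κ * X * κᴴ) * mat ((k⁻¹ : stabilizer U21 x₀) : U21)) ∂haar =
      ∫ k : stabilizer U21 x₀, Θ (mat (k : U21) * X * mat ((k⁻¹ : stabilizer U21 x₀) : U21)) ∂haar := by
  set k₀ : stabilizer U21 x₀ := ⟨mkU21 κ (conjTranspose_mul_J_mul_of_unitary_comm_J hκ hκJ), mkU21_smul_x₀_of_unitary_comm_J hκ hκJ⟩ with hk₀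
  have h1 : mat (k₀ : U21) = κ := rfl
  have h2 : mat ((k₀⁻¹ : stabilizer U21 x₀) : U21) = κᴴ := by
    rw [Subgroup.coe_inv, mat_inv, h1]
    have hJt : Jᴴ = J := by
      rw [J, Matrix.diagonal_conjTranspose]; congr 1; funext i; fin_cases i <;> simp
    have hJ : κᴴ * J = J * κᴴ := by
      have := congrArg Matrix.conjTranspose hκJ
      rw [Matrix.conjTranspose_mul, Matrix.conjTranspose_mul, hJt] at this
      exact this.symm
    rw [← hJ, Matrix.mul_assoc, J_mul_J, Matrix.mul_one]
  have h := kAverage_conj Θ k₀ X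
  rw [h1, h2] at h
  exact h

end EdTwo

end BallModel

end Literature.Geometry.ComplexHyperbolic

end
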